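import Mathlib
import Literature.Geometry.Symplectic.JHolomorphicMap
import Summits.SmoothPoincare4.SmoothPoincare4.Theorems.SullivanDualTameOrBrodyR4PencilDefs
import Summits.SmoothPoincare4.SmoothPoincare4.Theorems.SullivanDualTameOrBrodyR4StubExteriorSchwarz
import Summits.SmoothPoincare4.SmoothPoincare4.Theorems.SullivanDualTameOrBrodyR4StubConfineQ
import Summits.SmoothPoincare4.SmoothPoincare4.Theorems.SullivanDualTameOrBrodyR4StubSigmaGrowth
import Summits.SmoothPoincare4.SmoothPoincare4.Theorems.SullivanDualTameOrBrodyR4StubFarInverse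
import Summits.SmoothPoincare4.SmoothPoincare4.Theorems.SullivanDualTameOrBrodyR4BlowUp

/-!
# Normalisation and confinement of pencil members (crux `TameOrBrodyR4`, stmt-SmoothPoincare4-7826, line `Sketch`, skeleton v8 §3 — lead prover file)

The classical estimates of the continuity method for Gromov's anchored pencils (vocabulary
`Theorems/SullivanDualTameOrBrodyR4PencilDefs.lean`): for a NORMALISED MEMBER `u` of the pencil in
direction `P` with non-honest asymptotic value `|b| < 2R` (`IsPencilMember J R P Q b u`, `J` standard
on `‖x‖ ≥ R` in the frame `(P, Q)`), uniformly in the member,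

* `|Q ∘ u| ≤ 2R` (maximum principle, `stub_confineQ`);
* `|P (u ξ)| ≤ |ξ| + 8R` and `|P (u ξ)| > 2R` for `|ξ| > 4R` (the far inverse `ψ` of `P ∘ u`,
  `stub_farInverse`, is univalent on `{|c| > 2R}` with `ψ(c) - c → 0`; the growth theorem for such
  maps, `stub_sigmaGrowth`: omitted values have modulus `≤ 4R`, `|ψ(c)| ≥ |c| - 8R`);
* `|P (u ξ) - ξ| ≤ 120R²/|ξ|` for `|ξ| ≥ 6R` and `|Q (u ξ) - b| ≤ 16R²/|P (u ξ)|` where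
  `|P (u ξ)| ≥ 4R` (Schwarz's lemma at infinity, `stub_exteriorSchwarz`, for `P ∘ u - id` and for
  `Q ∘ u ∘ ψ - b`);
* hence the confinement `‖u ξ‖ ≤ |ξ| + 10R`

(registered helper `helper_memberEstimates`), and the packaging of a sequence with confined values
but unbounded first derivatives on a disc into BLOW-UP DATA (`Continuity.blowup_of_unbounded`).
These feed the closedness step and the assembly of the continuity method (`stub_continuity`).

References: M. Gromov, Invent. Math. 82 (1985), §2.4.A; Ch. Pommerenke, *Boundary Behaviour of
Conformal Maps* (1992), Thm 1.3 (growth theorem).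
-/

-- the registered namespace `Summit.SmoothPoincare4.SmoothPoincare4.…` repeats a component
set_option linter.dupNamespace false

noncomputable section

open scoped ContDiff Topology
open Filter Set Metric Literature.Geometry.Symplectic

namespace Summit.SmoothPoincare4.SmoothPoincare4.Cruxes.TameOrBrodyR4.Sketch

/-- Local notation for the model space `ℝ⁴ = EuclideanSpace ℝ (Fin 4)`. -/
local notation "E4" => EuclideanSpace ℝ (Fin 4)

namespace Continuity

/-- A coordinate of a flat-`J`-holomorphic map is complex differentiable at every parameter whose
image lies where `J` is `i` on that coordinate. -/
theorem differentiableAt_coord {J : E4 → E4 →L[ℝ] E4} {R : ℝ} (L : E4 →L[ℝ] ℂ)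
    (hJL : ∀ x : E4, R ≤ ‖x‖ → ∀ v, L (J x v) = Complex.I * L v) {u : ℂ → E4}
    (hu : ContDiff ℝ ∞ u) (huJ : IsJHolomorphicFlat J u) {ξ : ℂ} (hξ : R ≤ ‖u ξ‖) :
    DifferentiableAt ℂ (fun ξ => L (u ξ)) ξ := by
  have hud : DifferentiableAt ℝ u ξ := hu.differentiable (by simp) ξ
  have hLu : DifferentiableAt ℝ (fun ξ => L (u ξ)) ξ := L.differentiableAt.comp ξ hud
  rw [differentiableAt_iff_restrictScalars ℝ hLu]
  refine exists_restrictScalars_eq_of_map_mul_I (fderiv ℝ (fun ξ => L (u ξ)) ξ) fun ζ => ?_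
  have hch : fderiv ℝ (fun ξ => L (u ξ)) ξ = L.comp (fderiv ℝ u ξ) := by
    rw [show (fun ξ => L (u ξ)) = L ∘ u from rfl, fderiv_comp ξ L.differentiableAt hud,
      ContinuousLinearMap.fderiv]
  rw [hch, ContinuousLinearMap.comp_apply, ContinuousLinearMap.comp_apply, huJ ξ ζ, hJL _ hξ,
    smul_eq_mul]

/-- A continuous function on `ℂ` tending to `0` at infinity is bounded. -/
theorem exists_bound_of_tendsto_zero {f : ℂ → ℂ} (hf : Continuous f)
    (h0 : Tendsto f (cocompact ℂ) (𝓝 0)) : ∃ M : ℝ, ∀ z, ‖f z‖ ≤ M := by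
  have h1 : ∀ᶠ z in cocompact ℂ, ‖f z‖ < 1 := by
    have := (NormedAddGroup.tendsto_nhds_zero.mp h0) 1 one_pos
    exact this
  rw [Filter.eventually_iff, Filter.mem_cocompact] at h1
  obtain ⟨K, hK, hKs⟩ := h1
  obtain ⟨M, hM⟩ := hK.exists_bound_of_continuousOn hf.continuousOn
  refine ⟨max M 1, fun z => ?_⟩
  by_cases hz : z ∈ K
  · exact (hM z hz).trans (le_max_left _ _)
  · exact (le_of_lt (hKs hz)).trans (le_max_right _ _)

/-- `ψ c - c → 0` at infinity forces `ψ → ∞` at infinity. -/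
theorem tendsto_cocompact_of_sub_tendsto_zero {ψ : ℂ → ℂ}
    (h : Tendsto (fun c => ψ c - c) (cocompact ℂ) (𝓝 0)) :
    Tendsto ψ (cocompact ℂ) (cocompact ℂ) := by
  have h1 : ∀ᶠ c in cocompact ℂ, ‖ψ c - c‖ < 1 :=
    (NormedAddGroup.tendsto_nhds_zero.mp h) 1 one_pos
  have h2 : Tendsto (fun c : ℂ => ‖c‖ + (-1)) (cocompact ℂ) atTop :=
    tendsto_atTop_add_const_right _ _ tendsto_norm_cocompact_atTop
  refine tendsto_cocompact_of_tendsto_dist_comp_atTop (0 : ℂ) ?_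
  refine tendsto_atTop_mono' _ ?_ h2
  filter_upwards [h1] with c hc
  rw [dist_zero_right]
  linarith [norm_sub_norm_le c (ψ c), norm_sub_rev c (ψ c)]

/-- **Blow-up packaging.** Maps with values bounded by `C` on the disc of radius `ρ + 1` but
first derivatives unbounded on the disc of radius `ρ` give blow-up data (translate the bad
points to the origin). -/
theorem blowup_of_unbounded (J : E4 → E4 →L[ℝ] E4) (u : ℕ → ℂ → E4)
    (hu : ∀ n, ContDiff ℝ ∞ (u n)) (huJ : ∀ n, IsJHolomorphicFlat J (u n)) (ρ C : ℝ)
    (hK : ∀ n (z : ℂ), ‖z‖ ≤ ρ + 1 → ‖u n z‖ ≤ C)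
    (hunb : ∀ M : ℝ, ∃ n, ∃ z : ℂ, ‖z‖ ≤ ρ ∧ M < ‖fderiv ℝ (u n) z‖) :
    ∃ (K : Set E4) (f : ℕ → ℂ → E4), IsCompact K ∧ (∀ n, ContDiff ℝ ∞ (f n)) ∧
      (∀ n, IsJHolomorphicFlat J (f n)) ∧ (∀ n (z : ℂ), ‖z‖ ≤ 1 → f n z ∈ K) ∧
      Tendsto (fun n => ‖fderiv ℝ (f n) 0‖) atTop atTop := by
  choose n z hz hM using fun k : ℕ => hunb k
  refine ⟨closedBall 0 C, fun k η => u (n k) (z k + η), isCompact_closedBall 0 C,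
    fun k => (hu _).comp (contDiff_const.add contDiff_id),
    fun k => BlowUp.isJHolomorphicFlat_comp_add_left (huJ _) (z k), fun k η hη => ?_, ?_⟩
  · rw [mem_closedBall_zero_iff]
    exact hK _ _ ((norm_add_le _ _).trans (add_le_add (hz k) hη))
  · refine tendsto_atTop_mono (fun k => ?_) tendsto_natCast_atTop_atTop
    rw [fderiv_comp_add_left, add_zero]
    exact (hM k).le

end Continuity

/-- **Registered helper `helper_memberEstimates`: normalisation and confinement of a non-honest
member** (`|b| < 2R`), uniformly in the member: (i)
`|Q ∘ u| ≤ 2R`; (ii) `|P (u ξ)| ≤ |ξ| + 8R`; (iii) `|P (u ξ)| > 2R` for `|ξ| > 4R`; (iv)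
`|P (u ξ) - ξ| ≤ 120R²/|ξ|` for `|ξ| ≥ 6R`; (v) `|Q (u ξ) - b| ≤ 16R²/|P (u ξ)|` wherever
`|P (u ξ)| ≥ 4R`; (vi) `‖u ξ‖ ≤ |ξ| + 10R`. -/
theorem helper_memberEstimates (J : E4 → E4 →L[ℝ] E4) (R : ℝ) (P Q : E4 →L[ℝ] ℂ) (eP eQ : ℂ →L[ℝ] E4)
    (hR : 0 < R) (hPQ : IsCoordFrame P Q eP eQ)
    (hJP : ∀ x : E4, R ≤ ‖x‖ → ∀ v, P (J x v) = Complex.I * P v)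
    (hJQ : ∀ x : E4, R ≤ ‖x‖ → ∀ v, Q (J x v) = Complex.I * Q v)
    {b : ℂ} {u : ℂ → E4} (hm : IsPencilMember J R P Q b u) (hb : ‖b‖ < 2 * R) :
    (∀ ξ, ‖Q (u ξ)‖ ≤ 2 * R) ∧ (∀ ξ, ‖P (u ξ)‖ ≤ ‖ξ‖ + 8 * R) ∧
      (∀ ξ : ℂ, 4 * R < ‖ξ‖ → 2 * R < ‖P (u ξ)‖) ∧
      (∀ ξ : ℂ, 6 * R ≤ ‖ξ‖ → ‖P (u ξ) - ξ‖ ≤ 120 * R ^ 2 / ‖ξ‖) ∧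
      (∀ ξ : ℂ, 4 * R ≤ ‖P (u ξ)‖ → ‖Q (u ξ) - b‖ ≤ 16 * R ^ 2 / ‖P (u ξ)‖) ∧
      (∀ ξ, ‖u ξ‖ ≤ ‖ξ‖ + 10 * R) := by
  obtain ⟨hu, huJ, -, -, h5, h6, h7, h8⟩ := hm
  have hPle := PencilDefs.norm_P_le hPQ
  have hQle := PencilDefs.norm_Q_le hPQ
  -- (i) the maximum principle
  have hi : ∀ ξ, ‖Q (u ξ)‖ ≤ 2 * R := stub_confineQ J R hR Q hQle hJQ u hu huJ b hb h5
  -- the far inverse and the growth theorem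
  obtain ⟨ψ, hψd, hψi, hψr, hψl, hψn, hhol, p₀, hp₀⟩ :=
    stub_farInverse J R hR P hPle hJP u hu huJ h6 h7 h8
  have h2R : 0 < 2 * R := by positivity
  have hsg : ∀ p : ℂ, ‖P (u p)‖ ≤ 2 * R →
      ‖p‖ ≤ 2 * (2 * R) ∧ ∀ c : ℂ, 2 * R < ‖c‖ → ‖c‖ - 4 * (2 * R) ≤ ‖ψ c‖ := fun p hp =>
    stub_sigmaGrowth (2 * R) h2R ψ hψd hψi hψn p fun c hc heq => by
      have := hψr c hc
      rw [heq] at this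
      rw [← this] at hc
      exact absurd hp (not_le.mpr hc)
  -- (iii)
  have hiii : ∀ ξ : ℂ, 4 * R < ‖ξ‖ → 2 * R < ‖P (u ξ)‖ := fun ξ hξ => by
    by_contra hle
    have := (hsg ξ (not_lt.mp hle)).1
    linarith
  -- (ii)
  have hii : ∀ ξ, ‖P (u ξ)‖ ≤ ‖ξ‖ + 8 * R := fun ξ => by
    rcases le_or_gt ‖P (u ξ)‖ (2 * R) with hle | hlt
    · linarith [norm_nonneg ξ]
    · have key := (hsg p₀ hp₀).2 (P (u ξ)) hlt
      rw [hψl ξ hlt] at key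
      linarith
  -- (iv) exterior Schwarz for `P ∘ u - id` on `{4R < |ξ|}`
  have hiv : ∀ ξ : ℂ, 6 * R ≤ ‖ξ‖ → ‖P (u ξ) - ξ‖ ≤ 120 * R ^ 2 / ‖ξ‖ := by
    have hdiff : DifferentiableOn ℂ (fun ξ => P (u ξ) - ξ) {ξ : ℂ | 4 * R < ‖ξ‖} := by
      intro ξ hξ
      refine DifferentiableAt.differentiableWithinAt ?_
      refine (hhol ξ ?_).sub differentiableAt_id
      have := hiii ξ hξ
      linarith [hPle (u ξ)]
    have hcont : Continuous fun ξ => P (u ξ) - ξ :=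
      (P.continuous.comp hu.continuous).sub continuous_id
    obtain ⟨M, hM⟩ := Continuity.exists_bound_of_tendsto_zero hcont h6
    have key := stub_exteriorSchwarz (fun ξ => P (u ξ) - ξ) (4 * R) (6 * R) (20 * R)
      (by positivity) (by linarith) hdiff ⟨M, fun c _ => hM c⟩ h6 (fun c hc => by
        calc ‖P (u c) - c‖ ≤ ‖P (u c)‖ + ‖c‖ := norm_sub_le _ _
          _ ≤ (‖c‖ + 8 * R) + ‖c‖ := by linarith [hii c]
          _ = 20 * R := by rw [hc]; ring)
    intro ξ hξ
    have := key ξ hξ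
    calc ‖P (u ξ) - ξ‖ ≤ 20 * R * (6 * R) / ‖ξ‖ := this
      _ = 120 * R ^ 2 / ‖ξ‖ := by ring
  -- (v) exterior Schwarz for `Q ∘ u ∘ ψ - b` on `{2R < |c|}`
  have hv : ∀ ξ : ℂ, 4 * R ≤ ‖P (u ξ)‖ → ‖Q (u ξ) - b‖ ≤ 16 * R ^ 2 / ‖P (u ξ)‖ := by
    set q : ℂ → ℂ := fun c => Q (u (ψ c)) - b with hq
    have hdiff : DifferentiableOn ℂ q {c : ℂ | 2 * R < ‖c‖} := by
      intro c hc
      have hc' : 2 * R < ‖c‖ := hc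
      have hfar : R ≤ ‖u (ψ c)‖ := by
        have := hPle (u (ψ c))
        rw [hψr c hc'] at this
        linarith
      exact (DifferentiableAt.comp_differentiableWithinAt (g := fun ξ => Q (u ξ)) (f := ψ) c
        (Continuity.differentiableAt_coord Q hJQ hu huJ hfar) (hψd c hc)).sub_const b
    have hb4 : ∀ c, ‖q c‖ ≤ 4 * R := fun c =>
      calc ‖q c‖ ≤ ‖Q (u (ψ c))‖ + ‖b‖ := norm_sub_le _ _
        _ ≤ 2 * R + 2 * R := add_le_add (hi _) hb.le
        _ = 4 * R := by ring
    have hq0 : Tendsto q (cocompact ℂ) (𝓝 0) := by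
      have h1 : Tendsto (fun c => Q (u (ψ c))) (cocompact ℂ) (𝓝 b) :=
        h5.comp (Continuity.tendsto_cocompact_of_sub_tendsto_zero hψn)
      have := h1.sub_const b
      rwa [sub_self] at this
    have key := stub_exteriorSchwarz q (2 * R) (4 * R) (4 * R) h2R (by linarith) hdiff
      ⟨4 * R, fun c _ => hb4 c⟩ hq0 (fun c _ => hb4 c)
    intro ξ hξ
    have hlt : 2 * R < ‖P (u ξ)‖ := by linarith
    have := key (P (u ξ)) hξ
    rw [hq] at this
    simp only [hψl ξ hlt] at this
    calc ‖Q (u ξ) - b‖ ≤ 4 * R * (4 * R) / ‖P (u ξ)‖ := this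
      _ = 16 * R ^ 2 / ‖P (u ξ)‖ := by ring
  refine ⟨hi, hii, hiii, hiv, hv, fun ξ => ?_⟩
  -- (vi)
  have h1 := hPQ.1 (u ξ)
  have h2 := hii ξ
  have h3 := hi ξ
  nlinarith [norm_nonneg (u ξ), norm_nonneg ξ, norm_nonneg (P (u ξ)), norm_nonneg (Q (u ξ)),
    hR.le]


end Summit.SmoothPoincare4.SmoothPoincare4.Cruxes.TameOrBrodyR4.Sketch
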